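import Literature.MathematicalPhysics.QuantumFieldTheory.BlockScaleEffectivePerturbation
import HarnessLib

/-!
# Uneven axial block averaging of a lattice gauge field

Definition request `defn-UnevenAxialBlocking` (wanted by `stmt-QuantumFields-8892`, line
`two-scale-lsi-handover` of crux `RobustYangMillsHandover`; the formulas are those of §0 of that
line's skeleton, there for `d = 4`, here for any `d` and any group `G`).

Bałaban's renormalization transformation `(Tρ)(V) = ∫ dU δ(Ū V⁻¹) ρ(U)` (CMP 119 (1988) p. 243
(0.1)) averages the gauge field of a fine torus to a field `Ū` on the block torus; in the block
axial gauge the averaged variable of the block link `(y, μ)` is the straight-line transporter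
`U(by, μ) U(by + e_μ, μ) ⋯ U(by + (b-1)e_μ, μ)` between block representatives (CMP 95 (1984) §1
(1.4)–(1.7); the tree's `GaugeBlockAveraging.axial b S`, fine side `b · S`). In Bałaban's papers the
fine side is always a multiple of the block factor. The tree's lattice-gap clauses
(`HasLatticeMassGap`, `QCDScheme.HasLatticeMassGap`) quantify over ALL odd torus sides, so a blocking
argument towards them must block fine tori of side `N` NOT divisible by `b`. The **uneven axial
blocking** `unevenAxialLink b N T : GaugeConfig d N G → GaugeConfig d T G` does this bookkeeping:
block site `y ↦` representative `b · y` (coordinatewise on representatives in `{0,…,T-1}`,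
`unevenCorner`); block link `(y, μ) ↦` straight transporter from `b · y` in direction `μ` of length
`b`, except for the LAST block in direction `μ` (`y_μ = T-1`), whose path has length `N - b(T-1)`
(`unevenLen`) and absorbs the remainder; for `bT ≤ N < b(T+2)` all lengths lie in `[b, 3b)`.

## Content (everything proved; no named fact)

* paths: `transport_append` (concatenation), `transport_mul_of_forall_eq_one` (locality),
  `mem_pathEdges_replicate`;
* `unevenCorner`, `unevenLen`, `unevenAxialLink`, length bounds (`le_unevenLen`, `unevenLen_lt`,
  `unevenLen_pos`), agreement with `GaugeBlockAveraging.axial` at `N = b · S`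
  (`unevenAxialLink_eq_axial_link`);
* `pathEnd_unevenCorner_replicate` (for `b(T-1) ≤ N` the path of `(y, μ)` ends at the representative
  of `y + e_μ`, the last one by wrapping around the cycle), whence **gauge covariance**
  `unevenAxialLink_gaugeTransform`: `Ū(U^g) = Ū(U)^{g ∘ unevenCorner}` (CMP 95 (1984) (1.7));
* **tiling**: the `T` consecutive lengths in one direction sum to `N` (`sum_unevenLen`) and the paths
  concatenate to the loop winding once around the fine torus, whose holonomy is therefore the
  ordered product of the `T` block links on the block cycle
  (`transport_replicate_eq_prod_unevenAxialLink`);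
* `measurable_unevenAxialLink`, and the **push-forward of product Haar measure**
  `map_unevenAxialLink_torusLinkHaar`: for `0 < b`, `b(T-1) < N` the image of `∏ dU_e` is `∏ dV_e`
  (Bałaban's normalization identity `∫ dU (Tρ)(U) = ∫ dU ρ(U)`, CMP 102 (1985) (6), at `ρ = 1`).
  Proof: left-multiplying the FIRST link of each path by `h(y, μ)` (`unevenLift`) preserves product
  Haar measure and multiplies the block field on the left by `h` (`unevenAxialLink_unevenLift_mul`),
  so the image is a left-invariant probability measure on the compact group `G^{links}`, hence
  product Haar by uniqueness (`Measure.haarMeasure_unique`); the free-boundary `ℤ^d` analogue with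
  densities is the tree's `map_axialBlockHolonomy_withDensity` (`QuantumLattice/BalabanRGHaarIterates`).
  Corollaries: `lintegral_comp_unevenAxialLink`, and for the even blocking
  `GaugeBlockAveraging.map_axial_link_torusLinkHaar`, `GaugeBlockAveraging.axial_isBlockingOf_one`.

## Design notes

* Junk regime: for `b(T-1) > N` the last length is `0` (truncated subtraction) and gauge covariance
  FAILS (the last block link is the constant `1`); covariance and tiling carry `b(T-1) ≤ N`, the
  Haar push-forward the sharper `0 < b ∧ b(T-1) < N` (distinct block links have disjoint, non-empty
  paths). The requester's window `bT ≤ N < b(T+2)` implies all of these.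
* `[SecondCountableTopology G]` in the measure-theoretic part (measurability of the group law,
  `Pi.borelSpace`), as in `BalabanRGHaarIterates`; compact matrix groups qualify.
* NOT here: blocked DENSITIES of weighted measures (cf. `GaugeBlockAveraging.IsBlockingOf`),
  hypercubic symmetry of the blocking, iteration.

## References

* T. Bałaban, *Propagators and renormalization transformations for lattice gauge theories. I*,
  CMP 95 (1984) 17–40, §1 (1.4)–(1.7): axial-gauge block link variables as straight-line
  transporters, gauge covariance (paywalled here, acq-03744; the locator is the one of the tree's
  `transport` and `GaugeBlockAveraging.axial`). [Balaban1984Propagators]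
* T. Bałaban, *Convergent renormalization expansions for lattice gauge theories*, CMP 119 (1988)
  243–285, p. 243 (0.1) (held `paper:doi-10-1007-bf01217741`, p. 1): the transformation `T`, "we may
  take any averaging operation satisfying several general properties". [Balaban1988Convergent]
* T. Bałaban, *Ultraviolet stability of three-dimensional lattice pure gauge field theories*, CMP 102
  (1985) 255–275, Introduction (6): `∫ dU ρ_k = ∫ dU T^k ρ_0 = ∫ dU ρ_0` (read from the open
  deepblue.lib.umich.edu copy). [Balaban1985UV3]
-/

noncomputable section

open _root_.MeasureTheory
open Literature.MathematicalPhysics.QuantumLattice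

namespace Literature.MathematicalPhysics.QuantumFieldTheory

variable {d : ℕ} {G : Type*}

/-! ### Paths on the torus: concatenation and locality of parallel transport -/

section Paths

variable {L : ℕ}

/-- The endpoint of a concatenated path. [folklore] -/
theorem pathEnd_append (c : Site d L) (is js : List (Fin d)) :
    pathEnd c (is ++ js) = pathEnd (pathEnd c is) js :=
  List.foldl_append

/-- **Concatenation of parallel transporters**: `U(Γ₁ ∘ Γ₂) = U(Γ₁) U(Γ₂)` for the path `Γ₁` from `c`
followed by `Γ₂` from its endpoint. [folklore] -/
theorem transport_append [Monoid G] (U : GaugeConfig d L G) (c : Site d L) (is js : List (Fin d)) :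
    transport U c (is ++ js) = transport U c is * transport U (pathEnd c is) js := by
  induction is generalizing c with
  | nil => simp
  | cons i is ih => rw [List.cons_append, transport_cons, transport_cons, ih, pathEnd_cons, mul_assoc]

/-- The edges of the path `c, i :: is` are `(c, i)` and the edges of the path from `c + eᵢ`. [folklore] -/
@[simp] theorem pathEdges_cons (c : Site d L) (i : Fin d) (is : List (Fin d)) :
    pathEdges c (i :: is) = (c, i) :: pathEdges (c.shift i) is := rfl

/-- The empty path has no edges. [folklore] -/
@[simp] theorem pathEdges_nil (c : Site d L) : pathEdges c ([] : List (Fin d)) = [] := rfl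

/-- **Locality of parallel transport**: multiplying the gauge field on the left by a field `V` that is
trivial on the edges of the path does not change the transporter. [folklore] -/
theorem transport_mul_of_forall_eq_one [Monoid G] (V U : GaugeConfig d L G) (c : Site d L)
    (is : List (Fin d)) (h : ∀ f ∈ pathEdges c is, V f = 1) :
    transport (V * U) c is = transport U c is := by
  induction is generalizing c with
  | nil => simp
  | cons i is ih =>
    rw [transport_cons, transport_cons, Pi.mul_apply, h (c, i) (by simp), one_mul,
      ih _ fun f hf => h f (by simp [hf])]

/-- The edges of the straight path of `n` steps in direction `μ` from `c` are the
`(c + t e_μ, μ)`, `t < n`. [folklore] -/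
theorem mem_pathEdges_replicate {c : Site d L} {μ : Fin d} {n : ℕ} {f : Edge d L}
    (hf : f ∈ pathEdges c (List.replicate n μ)) :
    f.2 = μ ∧ ∃ t : ℕ, t < n ∧ f.1 = c + t • (Pi.single μ (1 : ZMod L) : Site d L) := by
  induction n generalizing c with
  | zero => simp at hf
  | succ n ih =>
    rw [List.replicate_succ, pathEdges_cons, List.mem_cons] at hf
    rcases hf with rfl | hf
    · exact ⟨rfl, 0, n.succ_pos, by simp⟩
    · obtain ⟨h2, t, ht, h1⟩ := ih hf
      refine ⟨h2, t + 1, Nat.succ_lt_succ ht, ?_⟩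
      rw [h1, Site.shift, add_assoc, succ_nsmul']

end Paths

/-! ### Block representatives and uneven path lengths -/

section Geometry

variable (b N T : ℕ)

/-- Fine-lattice representative (base corner) `b · y` of the block site `y` of the block torus of
side `T`, for nominal block factor `b`, inside the fine torus of side `N`: coordinatewise
`b · y_i` on representatives `y_i ∈ {0, …, T-1}` (for `N = b · T` this is the tree's
`torusBlockCorner b T`, `unevenCorner_eq_torusBlockCorner`). [folklore] -/
def unevenCorner (y : Site d T) : Site d N :=
  fun i => ((b * (y i).val : ℕ) : ZMod N)

/-- Length (in fine lattice units) of the straight block-link path from the representative of `y` in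
direction `μ`: `b`, except for the LAST block in that direction (`y_μ = T - 1`), whose path has
length `N - b (T - 1)` and so absorbs the remainder of `N` (truncated subtraction: `0` in the junk
regime `b (T-1) > N`). [folklore] -/
def unevenLen (y : Site d T) (μ : Fin d) : ℕ :=
  if (y μ).val + 1 = T then N - b * (T - 1) else b

/-- **Uneven axial block averaging of the gauge field**: the block link `(y, μ)` of the torus of
side `T` carries the straight-line parallel transporter (tree `transport`) of the fine field on the
torus of side `N` from the representative `b · y` of `y`, of `unevenLen b N T y μ` steps in direction
`μ` — Bałaban's block link variable in the block axial gauge,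
`Ū(y, μ) = U(by, μ) U(by + e_μ, μ) ⋯` (CMP 95 (1984) §1 (1.4)–(1.7); the tree's
`GaugeBlockAveraging.axial` is the case `N = b · T`, `unevenAxialLink_eq_axial_link`), adapted to
fine tori whose side is not a multiple of the block factor by letting the last block in each
direction absorb the remainder (this adaptation is bookkeeping of the tree, not in the source).
[cite: Balaban1984Propagators, §1 (1.4)–(1.7)] -/
def unevenAxialLink [Monoid G] (U : GaugeConfig d N G) : GaugeConfig d T G :=
  fun e => transport U (unevenCorner b N T e.1) (List.replicate (unevenLen b N T e.1 e.2) e.2)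

variable {b N T}

/-- Unfolding `unevenCorner`. [folklore] -/
theorem unevenCorner_apply (y : Site d T) (i : Fin d) :
    unevenCorner b N T y i = ((b * (y i).val : ℕ) : ZMod N) := rfl

/-- Unfolding `unevenAxialLink`. [folklore] -/
theorem unevenAxialLink_apply [Monoid G] (U : GaugeConfig d N G) (e : Edge d T) :
    unevenAxialLink b N T U e =
      transport U (unevenCorner b N T e.1) (List.replicate (unevenLen b N T e.1 e.2) e.2) := rfl

/-- Away from the last block the path length is `b`. [folklore] -/
theorem unevenLen_of_ne {y : Site d T} {μ : Fin d} (h : (y μ).val + 1 ≠ T) :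
    unevenLen b N T y μ = b := if_neg h

/-- The last block in direction `μ` has path length `N - b (T-1)`. [folklore] -/
theorem unevenLen_of_eq {y : Site d T} {μ : Fin d} (h : (y μ).val + 1 = T) :
    unevenLen b N T y μ = N - b * (T - 1) := if_pos h

/-- In the window `b T ≤ N` every path has length at least `b`. [folklore] -/
theorem le_unevenLen [NeZero T] (hlo : b * T ≤ N) (y : Site d T) (μ : Fin d) :
    b ≤ unevenLen b N T y μ := by
  unfold unevenLen
  split_ifs with h
  · have hT : b * T = b * (T - 1) + b := by
      obtain ⟨T', rfl⟩ := Nat.exists_eq_add_one_of_ne_zero (NeZero.ne T)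
      rw [Nat.add_sub_cancel, mul_add_one]
    omega
  · exact le_rfl

/-- In the window `N < b (T+2)` every path has length less than `3b`. [folklore] -/
theorem unevenLen_lt [NeZero T] (hhi : N < b * (T + 2)) (y : Site d T) (μ : Fin d) :
    unevenLen b N T y μ < 3 * b := by
  have hb : 0 < b := by
    rcases Nat.eq_zero_or_pos b with rfl | hb
    · simp at hhi
    · exact hb
  have hT : b * (T + 2) = b * (T - 1) + 3 * b := by
    obtain ⟨T', rfl⟩ := Nat.exists_eq_add_one_of_ne_zero (NeZero.ne T)
    rw [Nat.add_sub_cancel]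
    ring
  unfold unevenLen
  split_ifs with h
  · omega
  · omega

/-- If `0 < b` and `b (T-1) < N`, every path has at least one link. [folklore] -/
theorem unevenLen_pos (hb : 0 < b) (hN : b * (T - 1) < N) (y : Site d T) (μ : Fin d) :
    0 < unevenLen b N T y μ := by
  unfold unevenLen
  split_ifs
  · exact Nat.sub_pos_of_lt hN
  · exact hb

/-- For `b (T-1) ≤ N` the path of `(y, μ)` stays below height `N` in direction `μ`:
`b y_μ + ℓ(y, μ) ≤ N` (with equality exactly for the last block). [folklore] -/
theorem mul_val_add_unevenLen_le [NeZero T] (hN : b * (T - 1) ≤ N) (y : Site d T) (μ : Fin d) :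
    b * (y μ).val + unevenLen b N T y μ ≤ N := by
  have hlt := ZMod.val_lt (y μ)
  unfold unevenLen
  split_ifs with h
  · have h' : (y μ).val = T - 1 := by omega
    rw [h']
    omega
  · calc b * (y μ).val + b = b * ((y μ).val + 1) := by ring
      _ ≤ b * (T - 1) := Nat.mul_le_mul_left _ (by omega)
      _ ≤ N := hN

/-- The representatives are those of the tree's even blocking when `N = b · S`. [folklore] -/
theorem unevenCorner_eq_torusBlockCorner (b S : ℕ) (y : Site d S) :
    unevenCorner b (b * S) S y = torusBlockCorner b S y := rfl

/-- When `N = b · S` every path has length `b`. [folklore] -/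
theorem unevenLen_mul_self (b S : ℕ) [NeZero S] (y : Site d S) (μ : Fin d) :
    unevenLen b (b * S) S y μ = b := by
  unfold unevenLen
  split_ifs with h
  · obtain ⟨S', rfl⟩ := Nat.exists_eq_add_one_of_ne_zero (NeZero.ne S)
    rw [Nat.add_sub_cancel, mul_add_one, Nat.add_sub_cancel_left]
  · rfl

/-- **Compatibility with the even blocking**: for `N = b · S`, `T = S` the uneven axial blocking IS
the link map of the tree's `GaugeBlockAveraging.axial b S`. [folklore] -/
theorem unevenAxialLink_eq_axial_link [Group G] [MeasurableSpace G] [MeasurableMul₂ G] (b S : ℕ)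
    [NeZero S] (U : GaugeConfig d (b * S) G) :
    unevenAxialLink b (b * S) S U = (GaugeBlockAveraging.axial (G := G) b S).link U := by
  funext e
  rw [unevenAxialLink_apply, GaugeBlockAveraging.axial_link, unevenLen_mul_self,
    unevenCorner_eq_torusBlockCorner]

/-! ### The path of `(y, μ)` ends at the representative of `y + e_μ`; gauge covariance -/

/-- Shifting an updated coordinate. [folklore] -/
theorem shift_update (y : Site d T) (μ : Fin d) (a : ZMod T) :
    Site.shift (Function.update y μ a) μ = Function.update y μ (a + 1) := by
  funext i
  simp only [Site.shift, Pi.add_apply]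
  by_cases hi : i = μ
  · subst hi
    simp
  · simp [hi]

/-- **The uneven paths tile the torus locally**: for `b (T-1) ≤ N` the straight path of the block
link `(y, μ)` ends at the representative of the neighbouring block `y + e_μ` — for the last block
(`y_μ = T-1`) by wrapping around the fine cycle, `b(T-1) + (N - b(T-1)) = N ≡ 0`. [folklore] -/
theorem pathEnd_unevenCorner_replicate [NeZero T] (hN : b * (T - 1) ≤ N) (y : Site d T) (μ : Fin d) :
    pathEnd (unevenCorner b N T y) (List.replicate (unevenLen b N T y μ) μ) =
      unevenCorner b N T (y.shift μ) := by
  rw [pathEnd_eq_add, List.map_replicate, List.sum_replicate]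
  funext i
  simp only [Pi.add_apply, Pi.smul_apply, unevenCorner_apply, Site.shift]
  by_cases hi : i = μ
  · subst hi
    have hval : (y i + 1 : ZMod T).val = ((y i).val + 1) % T := by
      rw [ZMod.val_add, ZMod.val_one_eq_one_mod, Nat.add_mod_mod]
    rw [Pi.single_eq_same, Pi.single_eq_same, nsmul_one, hval, ← Nat.cast_add]
    by_cases h : (y i).val + 1 = T
    · rw [unevenLen_of_eq h, h, Nat.mod_self, mul_zero, Nat.cast_zero]
      have h' : (y i).val = T - 1 := by omega
      rw [h', Nat.add_sub_cancel' hN, ZMod.natCast_self]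
    · have hlt : (y i).val + 1 < T := lt_of_le_of_ne (ZMod.val_lt (y i)) h
      rw [unevenLen_of_ne h, Nat.mod_eq_of_lt hlt, mul_add, mul_one]
  · rw [Pi.single_eq_of_ne hi, Pi.single_eq_of_ne hi, smul_zero, add_zero, add_zero]

/-- **Gauge covariance of the uneven axial blocking** (Bałaban CMP 95 (1984) (1.7)): for
`b (T-1) ≤ N`, `Ū(U^g) = (Ū(U))^{g ∘ corner}`, i.e. the blocking commutes with gauge
transformations `g ↦ g ∘ unevenCorner b N T`. (False in the junk regime `b (T-1) > N`, where the
last block link is constant.) [cite: Balaban1984Propagators, §1 (1.7)] -/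
theorem unevenAxialLink_gaugeTransform [Group G] [NeZero T] (hN : b * (T - 1) ≤ N)
    (g : Site d N → G) (U : GaugeConfig d N G) :
    unevenAxialLink b N T (gaugeTransform g U) =
      gaugeTransform (g ∘ unevenCorner b N T) (unevenAxialLink b N T U) := by
  funext e
  change transport (gaugeTransform g U) _ _ =
    g (unevenCorner b N T e.1) * transport U _ _ * (g (unevenCorner b N T (e.1.shift e.2)))⁻¹
  rw [transport_gaugeTransform, pathEnd_unevenCorner_replicate hN]

/-- Gauge-invariant functions of the block field pull back to gauge-invariant functions of the fine
field. [folklore] -/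
theorem IsGaugeInvariant.comp_unevenAxialLink [Group G] [NeZero T] {α : Type*}
    {F : GaugeConfig d T G → α} (hF : IsGaugeInvariant F) (hN : b * (T - 1) ≤ N) :
    IsGaugeInvariant (F ∘ unevenAxialLink (G := G) b N T) := by
  intro g U
  simp only [Function.comp_apply, unevenAxialLink_gaugeTransform hN, hF _ _]

/-! ### Tiling: the `T` paths in one direction concatenate to the loop around the fine torus -/

/-- **Total length**: for `b (T-1) ≤ N` the `T` consecutive path lengths in direction `μ` add up
to the fine side `N` (`(T-1) · b + (N - b(T-1)) = N`). [folklore] -/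
theorem sum_unevenLen [NeZero T] (hN : b * (T - 1) ≤ N) (y : Site d T) (μ : Fin d) :
    ∑ j ∈ Finset.range T, unevenLen b N T (Function.update y μ (j : ZMod T)) μ = N := by
  have hval : ∀ j < T, ((j : ℕ) : ZMod T).val = j := fun j hj => ZMod.val_natCast_of_lt hj
  have h1 : ∀ j ∈ Finset.range (T - 1), unevenLen b N T (Function.update y μ (j : ZMod T)) μ = b := by
    intro j hj
    rw [Finset.mem_range] at hj
    apply unevenLen_of_ne
    rw [Function.update_self, hval j (by omega)]
    omega
  have h2 : unevenLen b N T (Function.update y μ ((T - 1 : ℕ) : ZMod T)) μ = N - b * (T - 1) := by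
    apply unevenLen_of_eq
    rw [Function.update_self, hval _ (Nat.sub_one_lt (NeZero.ne T))]
    exact Nat.sub_add_cancel NeZero.one_le
  have hT : Finset.range T = Finset.range (T - 1 + 1) := by rw [Nat.sub_add_cancel NeZero.one_le]
  rw [hT, Finset.sum_range_succ, Finset.sum_congr rfl h1, h2, Finset.sum_const, Finset.card_range,
    smul_eq_mul, mul_comm (T - 1) b]
  exact Nat.add_sub_cancel' hN

/-- Partial tiling: the first `k ≤ T` paths in direction `μ` from the representative of
`y[μ ↦ 0]` concatenate to the straight path of length `∑_{j<k} ℓ_j`, which ends at the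
representative of `y[μ ↦ k]`. [folklore] -/
theorem transport_replicate_sum_unevenLen [Monoid G] [NeZero T] (hN : b * (T - 1) ≤ N)
    (U : GaugeConfig d N G) (y : Site d T) (μ : Fin d) {k : ℕ} (hk : k ≤ T) :
    transport U (unevenCorner b N T (Function.update y μ 0))
        (List.replicate (∑ j ∈ Finset.range k, unevenLen b N T (Function.update y μ (j : ZMod T)) μ) μ) =
      ((List.range k).map fun j : ℕ =>
        unevenAxialLink b N T U (Function.update y μ (j : ZMod T), μ)).prod ∧
    pathEnd (unevenCorner b N T (Function.update y μ 0))
        (List.replicate (∑ j ∈ Finset.range k, unevenLen b N T (Function.update y μ (j : ZMod T)) μ) μ) =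
      unevenCorner b N T (Function.update y μ (k : ZMod T)) := by
  induction k with
  | zero => simp
  | succ k ih =>
    obtain ⟨ih1, ih2⟩ := ih (Nat.le_of_succ_le hk)
    rw [Finset.sum_range_succ, List.replicate_add, transport_append, pathEnd_append, ih1, ih2,
      pathEnd_unevenCorner_replicate hN, shift_update, List.range_succ, List.map_append,
      List.prod_append, List.map_cons, List.map_nil, List.prod_cons, List.prod_nil, mul_one,
      unevenAxialLink_apply, Nat.cast_succ]
    exact ⟨rfl, rfl⟩

/-- **Tiling around the torus** (the uneven paths partition the fine cycle): for `b (T-1) ≤ N` the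
straight loop of length `N` winding once around the fine torus in direction `μ` from the
representative of `y[μ ↦ 0]` has holonomy equal to the ordered product of the `T` block link
variables along the block cycle `y[μ ↦ 0], y[μ ↦ 1], …, y[μ ↦ T-1]`. [folklore] -/
theorem transport_replicate_eq_prod_unevenAxialLink [Monoid G] [NeZero T] (hN : b * (T - 1) ≤ N)
    (U : GaugeConfig d N G) (y : Site d T) (μ : Fin d) :
    transport U (unevenCorner b N T (Function.update y μ 0)) (List.replicate N μ) =
      ((List.range T).map fun j : ℕ =>
        unevenAxialLink b N T U (Function.update y μ (j : ZMod T), μ)).prod := by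
  have h := (transport_replicate_sum_unevenLen hN U y μ le_rfl).1
  rwa [sum_unevenLen hN] at h

end Geometry

/-! ### Measurability -/

section Measurable

variable [Group G] [MeasurableSpace G] [MeasurableMul₂ G] (b N T : ℕ)

/-- The uneven axial blocking is measurable (each block link is an ordered product of coordinate
projections). [folklore] -/
@[fun_prop] theorem measurable_unevenAxialLink : Measurable (unevenAxialLink (d := d) (G := G) b N T) :=
  measurable_pi_lambda _ fun _ => measurable_transport _ _

end Measurable

/-! ### First links and the Haar push-forward -/

section FirstLink

variable [Group G] {b N T : ℕ}

/-- The representatives of distinct block sites are distinct once `0 < b` and `b (T-1) < N`. [folklore] -/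
theorem unevenCorner_injective [NeZero T] (hb : 0 < b) (hN : b * (T - 1) < N) :
    Function.Injective (unevenCorner (d := d) b N T) := by
  intro y y' h
  funext i
  have hi := congrFun h i
  simp only [unevenCorner_apply] at hi
  have hy : b * (y i).val < N :=
    lt_of_le_of_lt (Nat.mul_le_mul_left _ (by have := ZMod.val_lt (y i); omega)) hN
  have hy' : b * (y' i).val < N :=
    lt_of_le_of_lt (Nat.mul_le_mul_left _ (by have := ZMod.val_lt (y' i); omega)) hN
  rw [ZMod.natCast_eq_natCast_iff', Nat.mod_eq_of_lt hy, Nat.mod_eq_of_lt hy'] at hi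
  exact ZMod.val_injective _ (Nat.eq_of_mul_eq_mul_left hb hi)

variable (b N T) in
/-- The FIRST fine link `(b · y, μ)` of the path of the block link `(y, μ)`. [folklore] -/
def unevenFirstEdge (e : Edge d T) : Edge d N := (unevenCorner b N T e.1, e.2)

/-- Distinct block links have distinct first links (`0 < b`, `b (T-1) < N`). [folklore] -/
theorem unevenFirstEdge_injective [NeZero T] (hb : 0 < b) (hN : b * (T - 1) < N) :
    Function.Injective (unevenFirstEdge (d := d) b N T) := by
  rintro ⟨y, μ⟩ ⟨y', μ'⟩ h
  simp only [unevenFirstEdge, Prod.mk.injEq] at h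
  exact Prod.ext (unevenCorner_injective hb hN h.1) h.2

/-- A later link of a path is never the first link of any path: for `1 ≤ s < ℓ(y, μ)` the fine link
`(b · y + s e_μ, μ)` is not of the form `(b · y', μ')`. [folklore] -/
theorem unevenFirstEdge_ne [NeZero T] (hN : b * (T - 1) < N) {y : Site d T} {μ : Fin d} {s : ℕ}
    (hs0 : 0 < s) (hs : s < unevenLen b N T y μ) (e' : Edge d T) :
    unevenFirstEdge b N T e' ≠ (unevenCorner b N T y + s • (Pi.single μ (1 : ZMod N) : Site d N), μ) := by
  intro h
  have hμ : e'.2 = μ := congrArg Prod.snd h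
  have h1 := congrFun (congrArg Prod.fst h) μ
  simp only [unevenFirstEdge, unevenCorner_apply, Pi.add_apply, Pi.smul_apply, Pi.single_eq_same,
    nsmul_one, ← Nat.cast_add] at h1
  have hend := mul_val_add_unevenLen_le hN.le y μ
  have hy' : b * (e'.1 μ).val ≤ b * (T - 1) :=
    Nat.mul_le_mul_left _ (by have := ZMod.val_lt (e'.1 μ); omega)
  rw [ZMod.natCast_eq_natCast_iff', Nat.mod_eq_of_lt (by omega), Nat.mod_eq_of_lt (by omega)] at h1
  -- `b y'_μ = b y_μ + s` with `0 < s < ℓ`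
  by_cases hlast : (y μ).val + 1 = T
  · rw [unevenLen_of_eq hlast] at hs
    have : (y μ).val = T - 1 := by omega
    rw [this] at h1
    omega
  · rw [unevenLen_of_ne hlast] at hs
    have hm1 : b * (y μ).val < b * (e'.1 μ).val := by omega
    have hm2 : b * (e'.1 μ).val < b * ((y μ).val + 1) := by rw [mul_add, mul_one]; omega
    have hlt1 : (y μ).val < (e'.1 μ).val := Nat.lt_of_mul_lt_mul_left hm1
    have hlt2 : (e'.1 μ).val < (y μ).val + 1 := Nat.lt_of_mul_lt_mul_left hm2
    omega

variable (b N T) in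
/-- The **first-link lift** of a block field `h`: the fine field equal to `h(y, μ)` on the first link
of the path of each block link `(y, μ)` and to `1` on all other fine links. [folklore] -/
def unevenLift (h : GaugeConfig d T G) : GaugeConfig d N G :=
  Function.extend (unevenFirstEdge b N T) h 1

/-- The lift takes the value `h e` on the first link of `e`. [folklore] -/
theorem unevenLift_unevenFirstEdge [NeZero T] (hb : 0 < b) (hN : b * (T - 1) < N)
    (h : GaugeConfig d T G) (e : Edge d T) :
    unevenLift b N T h (unevenFirstEdge b N T e) = h e :=
  (unevenFirstEdge_injective hb hN).extend_apply _ _ _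

/-- The lift is `1` off the first links. [folklore] -/
theorem unevenLift_of_forall_ne (h : GaugeConfig d T G) {f : Edge d N}
    (hf : ∀ e, unevenFirstEdge b N T e ≠ f) : unevenLift b N T h f = 1 := by
  rw [unevenLift, Function.extend_apply' _ _ _ (fun ⟨e, he⟩ => hf e he), Pi.one_apply]

/-- **Left-multiplying the first links multiplies the block field on the left**:
`Ū(L(h) · U) = h · Ū(U)` for `0 < b`, `b (T-1) < N` (every path starts with its own first link,
which no other path visits). [folklore] -/
theorem unevenAxialLink_unevenLift_mul [NeZero T] (hb : 0 < b) (hN : b * (T - 1) < N)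
    (h : GaugeConfig d T G) (U : GaugeConfig d N G) :
    unevenAxialLink b N T (unevenLift b N T h * U) = h * unevenAxialLink b N T U := by
  funext e
  obtain ⟨n, hn⟩ := Nat.exists_eq_succ_of_ne_zero (unevenLen_pos hb hN e.1 e.2).ne'
  rw [Pi.mul_apply, unevenAxialLink_apply, unevenAxialLink_apply, hn, List.replicate_succ,
    transport_cons, transport_cons, Pi.mul_apply, ← mul_assoc]
  have h1 : unevenLift b N T h (unevenCorner b N T e.1, e.2) = h e :=
    unevenLift_unevenFirstEdge hb hN h e
  rw [h1, transport_mul_of_forall_eq_one]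
  intro f hf
  obtain ⟨hf2, t, ht, hf1⟩ := mem_pathEdges_replicate hf
  apply unevenLift_of_forall_ne
  intro e' he'
  have hs : t + 1 < unevenLen b N T e.1 e.2 := by omega
  refine unevenFirstEdge_ne hN (Nat.succ_pos t) hs e' ?_
  rw [he', Prod.ext_iff]
  refine ⟨?_, hf2⟩
  rw [hf1, Site.shift, add_assoc, ← succ_nsmul']

end FirstLink

section Haar

variable [Group G] [MeasurableSpace G] [TopologicalSpace G] [IsTopologicalGroup G] [CompactSpace G]
  [BorelSpace G] [SecondCountableTopology G] {b N T : ℕ} [NeZero N] [NeZero T]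

/-- **The uneven axial blocking pushes product Haar measure to product Haar measure**: for `0 < b`
and `b (T-1) < N`, the image of `∏_{e ∈ links(N)} dU_e` under `unevenAxialLink b N T` is
`∏_{e ∈ links(T)} dV_e` — the block link variables of a Haar-distributed fine field are independent
and Haar distributed (the first link of each path is an independent uniform factor); Bałaban's
normalization identity `∫ dU (Tρ)(U) = ∫ dU ρ(U)` (CMP 102 (1985) (6)) at `ρ = 1`. Proof: the image
is a probability measure invariant under all left translations (`unevenAxialLink_unevenLift_mul` and
left invariance of product Haar under the fixed translation `unevenLift h`), hence THE Haar
probability measure of the compact group `G^{links(T)}` (`Measure.haarMeasure_unique`), as is the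
product measure. [cite: Balaban1985UV3, Introduction (6)] -/
theorem map_unevenAxialLink_torusLinkHaar (hb : 0 < b) (hN : b * (T - 1) < N) :
    (torusLinkHaar d G N).map (unevenAxialLink b N T) = torusLinkHaar d G T := by
  have hΦ : Measurable (unevenAxialLink (d := d) (G := G) b N T) := measurable_unevenAxialLink b N T
  set ν : Measure (GaugeConfig d T G) := (torusLinkHaar d G N).map (unevenAxialLink b N T) with hν
  haveI : IsProbabilityMeasure ν := Measure.isProbabilityMeasure_map hΦ.aemeasurable
  haveI : ν.IsMulLeftInvariant := by
    refine ⟨fun h => ?_⟩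
    rw [hν, Measure.map_map (measurable_const_mul h) hΦ]
    have hcomm : (fun V : GaugeConfig d T G => h * V) ∘ unevenAxialLink b N T =
        unevenAxialLink b N T ∘ fun U : GaugeConfig d N G => unevenLift b N T h * U :=
      funext fun U => (unevenAxialLink_unevenLift_mul hb hN h U).symm
    rw [hcomm, ← Measure.map_map hΦ (measurable_const_mul _), map_mul_left_eq_self]
  have h1 : ν = ν (⊤ : TopologicalSpace.PositiveCompacts (GaugeConfig d T G)) • Measure.haarMeasure ⊤ :=
    Measure.haarMeasure_unique ν ⊤
  have h2 : torusLinkHaar d G T =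
      torusLinkHaar d G T (⊤ : TopologicalSpace.PositiveCompacts (GaugeConfig d T G)) •
        Measure.haarMeasure ⊤ :=
    Measure.haarMeasure_unique _ ⊤
  rw [h1, h2, TopologicalSpace.PositiveCompacts.coe_top, measure_univ, measure_univ]

/-- Integrals of functions of the block field against product Haar measure of the fine torus are
product-Haar integrals on the block torus (change of variables along the blocking). [folklore] -/
theorem lintegral_comp_unevenAxialLink (hb : 0 < b) (hN : b * (T - 1) < N)
    {f : GaugeConfig d T G → ENNReal} (hf : Measurable f) :
    ∫⁻ U, f (unevenAxialLink b N T U) ∂torusLinkHaar d G N = ∫⁻ V, f V ∂torusLinkHaar d G T := by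
  rw [← map_unevenAxialLink_torusLinkHaar (d := d) (G := G) hb hN,
    lintegral_map hf (measurable_unevenAxialLink b N T)]

/-- The torus twin of `map_axialBlockHolonomy_withDensity` at unit weight, for the tree's even
blocking: `GaugeBlockAveraging.axial b S` pushes `∏ dU_e` on the torus of side `b · S` to `∏ dV_e`
on the torus of side `S` (`0 < b`). [folklore] -/
theorem GaugeBlockAveraging.map_axial_link_torusLinkHaar {S : ℕ} [NeZero b] [NeZero S] :
    (torusLinkHaar d G (b * S)).map (GaugeBlockAveraging.axial (G := G) b S).link =
      torusLinkHaar d G S := by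
  have h : (GaugeBlockAveraging.axial (d := d) (G := G) b S).link = unevenAxialLink b (b * S) S :=
    funext fun U => (unevenAxialLink_eq_axial_link b S U).symm
  have hb : 0 < b := Nat.pos_of_ne_zero (NeZero.ne b)
  rw [h]
  refine map_unevenAxialLink_torusLinkHaar hb ?_
  calc b * (S - 1) < b * (S - 1) + b := Nat.lt_add_of_pos_right hb
    _ = b * S := by
      obtain ⟨S', rfl⟩ := Nat.exists_eq_add_one_of_ne_zero (NeZero.ne S)
      rw [Nat.add_sub_cancel, mul_add_one]

/-- In particular the even axial blocking has blocked density `1` at unit weight: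
`T_axial(dU) = dV` (`GaugeBlockAveraging.IsBlockingOf`). [folklore] -/
theorem GaugeBlockAveraging.axial_isBlockingOf_one {S : ℕ} [NeZero b] [NeZero S] :
    (GaugeBlockAveraging.axial (d := d) (G := G) b S).IsBlockingOf 1 1 := by
  rw [GaugeBlockAveraging.IsBlockingOf, GaugeBlockAveraging.blockedWeight, withDensity_one,
    withDensity_one]
  exact GaugeBlockAveraging.map_axial_link_torusLinkHaar

end Haar

end Literature.MathematicalPhysics.QuantumFieldTheory
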